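import Summits.BirchSwinnertonDyer.BirchSwinnertonDyer.Theorems.SignedLowerHalvesSmallImageLowerHalfBothSignsRttD2TFTower
import Literature.NumberTheory.ComplexMultiplication.EllipticUnits.ImaginaryQuadraticMainConjectureCarriersO
import Summits.BirchSwinnertonDyer.BirchSwinnertonDyer.Theorems.PrintCf2RubinValueTwoJLKDescentRowOneOfClass
import HarnessLib

/-!
# Route `SignedLowerHalves`, crux L `SmallImageLowerHalfBothSigns` (stmt-BirchSwinnertonDyer-23599), line `rtt_w3` v17 — stub A INPUT (4′) «hTF», brick (TF-c):
# ★★★ `𝐇¹(𝒪_K[1/p𝔣], Λ_𝒪(θ)(1))` HAS NO `T₂`-TORSION — `torsionBy Λ_{𝒪,2} D.H (C (X − C 0)) = ⊥` for EVERY pinned `D : IwasawaCohomologyDataO S κ₁ κ₂ γ₁ γ₂ θ 𝔣 1`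
# of a topological generator pair up to units (the frame's `hγ`), every character `θ` and every `𝔣`

INPUTS hand `bsd-inputs-honda-p1` g25 under LEAD `cruxlead-stmt-BirchSwinnertonDyer-23599` g11/g12. This is the INPUT «hTF» (row (4′)) of the road-D frame assembly
`SmallImageRttCharRoadFrame₂.stub_charRoadFrame_ns_of₂` (p796938) in its TRUE form: the registered text of `stub_frameTF_ns` (v16/v17) quantifies over ALL `κ₂, γ₂` and is too
general (for `γ₂ ∈ pairKer` the element `T₂ = C X` acts as `conj_{γ₂} − 1 = 0`, and on a one-dimensional tower with trivial Tate-twisted coefficients `𝐇¹[T₂] ⊇ 𝒪 ≠ 0`);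
the frame itself carries `hγ : ∃ u₁ u₂, IsTopGeneratorPair (κc.unitTwist u₁) (κ₂.unitTwist u₂) γK⁻¹ γ₂` (conjunct 2 of its conclusion), under which the statement holds for every
`θ'` and every `𝔣` — this file. MATHEMATICS ([PerrinRiou1994Invent] §1.3, descent of Iwasawa cohomology): `𝐇¹_Iw(K̃_∞, T)[γ₂ − 1]` is a quotient of
`H⁰(G_{K,S}, Λ₂(T)/(γ₂ − 1)) = H⁰_Iw(K^{(1)}_∞, T) = lim←_m H⁰(K^{(1)}_m, T) = 0` (rank-one lattice, infinite `p`-tower along the `κ₁`-LINE `K^{(1)}_∞ = K̃_∞^{⟨γ₂⟩}`). IN LEAN, on the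
pinned data (no `Λ₂(T)`, no Shapiro for `Λ`-adic coefficients): an element `x` with `C X • x = 0` has `conj_{γ₂}`-FIXED level components `x_{n,k}` ((P6)); read in the permutation model
through g24's Shapiro dictionary `shO` (brick (δ-d2)) they form an `R_{πγ₂}`-invariant `Σ`-compatible family ((P1)), and brick (TF-b) `coindFinSum_pair_eq_zero_of_rTransHom_eq` kills
`x_{n,k} = Σ_{V̄_{m'}→V̄_n} x_{m',k}` for `m' = n + 2k + t + 1`, `#X_k ≤ p^t`; so `x = 0` by (P3).
* §1 the standing hypothesis `hV` (`N_{supp(p𝔣)} ≤ Gal(K̄/K̃_m)`) of bricks (δ-d1)/(TF-b) is DISCHARGED by the tree's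
  `PrintCf2.JLKDescent.ramificationSubgroup_suppPF_le_pairLayerSubgroup` (cf2 lane; ℤ_p-extensions are unramified outside `p`);
* §2 `symm_shO_proj_rTransHom` ((P6) read through `shO_rTransHom_one`), `coindFinSum_symm_shO_proj` ((P1) iterated, `shO_coindFinSum`);
* §3 ★★★ `torsionBy_C_X_eq_bot` and its `Submodule.torsionBy … = ⊥ ↔ ∀ x, C (X − C 0) • x = 0 → x = 0` reading `eq_zero_of_C_X_smul_eq_zero`.
USE (LEAD, `_of₃`): replace the hypothesis `hTF κ₂ γ₂ 𝔣 θ' D₁'` of `stub_charRoadFrame_ns_of₂` by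
`SmallImageRttD2TF.torsionBy_C_X_eq_bot S (κ.restrictOfFinrankEqTwo hp K hK2) κ₂ θ' 𝔣 ⟨u₁, u₂, hpair⟩ D₁'` (its `FiniteDimensional ℚ_[p] (padicCoeffField S)` instance is the frame's
`Module.finite_of_finrank_pos hS`); then `stub_frameTF_ns` leaves the skeleton. THEOREMS ONLY (`--supports stmt-BirchSwinnertonDyer-23599` helper); no named fact, no `sorry`; crux L,
crux M, E2 and BSD remain OPEN and are proved for NO curve by any of this.
References: [PerrinRiou1994Invent] §1.3; [JohnsonLeungKings2011] §4.2 Def. 4.2 (94), Lemma 4.4 (arXiv p0012); [Rubin2000] Ch. VI §6; [Washington1997] §13.1–§13.3, Prop. 13.2;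
[NeukirchSchmidtWingberg2008] (1.3.2)–(1.3.3), I §5–§6, VIII §3.
-/

set_option autoImplicit false
-- the Theorems namespace of this sub repeats the summit name by design (D-0017 nested layout)
set_option linter.dupNamespace false

noncomputable section

open scoped NumberField
open CategoryTheory Field IsDedekindDomain
open Literature.NumberTheory.GaloisRepresentations
open Literature.NumberTheory.EllipticCurves
open Literature.NumberTheory.ComplexMultiplication.EllipticUnits (IwasawaAlgebraO₂)
open Literature.NumberTheory.ComplexMultiplication.EllipticUnits.JohnsonLeungKings2011
open Summit.BirchSwinnertonDyer.BirchSwinnertonDyer.Theorems.SmallImageRttD2J2Delta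

namespace Summit.BirchSwinnertonDyer.BirchSwinnertonDyer.Theorems.SmallImageRttD2TF

variable {K : Type} [Field K] [NumberField K] {p : ℕ} [Fact p.Prime]

/-! ## §1 `N_{supp(p𝔣)} ≤ Gal(K̄/K̃_m)` — the standing hypothesis `hV` of bricks (δ-d1)/(δ-e)/(TF-b) is the tree's
`PrintCf2.JLKDescent.ramificationSubgroup_suppPF_le_pairLayerSubgroup` (cf2 lane, p-file `…PrintCf2RubinValueTwoJLKDescentRowOneOfClass.lean`): a `ℤ_p`-extension is
unramified outside `p` (`Greenberg2006.ramificationSubgroup_le_multiZpKer`). Reused, not restated. -/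

/-! ## §2 The level components of a `T₂`-torsion element in the permutation model -/

section Pinned

variable (S : Set (PadicAlgCl p)) [FiniteDimensional ℚ_[p] (padicCoeffField S)] (κ₁ κ₂ : ZpExtension K p) {γ₁ γ₂ : absoluteGaloisGroup K}
  (θ : absoluteGaloisGroup K →ₜ* (padicCoeffIntegers S)ˣ) (𝔣 : Ideal (𝓞 K)) (D : IwasawaCohomologyDataO S κ₁ κ₂ γ₁ γ₂ θ 𝔣 1)

attribute [local instance] totallyDisconnectedSpace_GS normal_imGS fintypeQuotLayer fintypeQuotPairLayer fintypeQuotPairInfLayer finite_invariantsOf_muTwistO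

omit [FiniteDimensional ℚ_[p] (padicCoeffField S)] in
/-- **(P6) in the permutation model**: if `C (X − C 0) • x = 0` then every level component `sh⁻¹(x_{n,k}) ∈ H¹(G_S, Maps(G_S ⧸ V̄_n, X_k))` is FIXED by the right translation `R_{π γ₂}`
(`T₂ = C X` acts as `conj_{γ₂} − 1`, and `conj_{γ₂} = sh ∘ H¹(R_{πγ₂}) ∘ sh⁻¹`, brick (δ-d2)). [cite: JohnsonLeungKings2011, §4.2 (arXiv p0012:L109–112)] [cite: SerreLocalFields1979, VII §5] -/
theorem symm_shO_proj_rTransHom (x : D.H)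
    (hx : (PowerSeries.C (PowerSeries.X - PowerSeries.C (0 : padicCoeffIntegers S)) : IwasawaAlgebraO₂ S) • x = 0) (n k : ℕ) :
    cohomologyMap (rTransHom (coeffGSO S (suppPF p 𝔣) θ k).toTopRep (imGS (suppPF p 𝔣) (pairLayerSubgroup κ₁ κ₂ n))
        (QuotientGroup.mk (toUnramifiedQuot K (suppPF p 𝔣) γ₂) : GaloisGroupUnramifiedOutside K (suppPF p 𝔣) ⧸ imGS (suppPF p 𝔣) (pairLayerSubgroup κ₁ κ₂ n))) 1
        ((shO S (suppPF p 𝔣) θ (isOpen_pairLayerSubgroup κ₁ κ₂ n) k 1).symm (D.proj n k x)) =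
      (shO S (suppPF p 𝔣) θ (isOpen_pairLayerSubgroup κ₁ κ₂ n) k 1).symm (D.proj n k x) := by
  rw [map_zero, sub_zero] at hx
  have h1 := D.proj_T₂_smul n k x
  rw [hx, map_zero, eq_comm, sub_eq_zero] at h1
  -- `conj_{γ₂} x_{n,k} = x_{n,k}`; transport through `sh`
  apply (shO S (suppPF p 𝔣) θ (isOpen_pairLayerSubgroup κ₁ κ₂ n) k 1).injective
  rw [shO_rTransHom_one, AddEquiv.apply_symm_apply]
  exact h1

omit [FiniteDimensional ℚ_[p] (padicCoeffField S)] in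
/-- **(P1) iterated, in the permutation model**: `sh⁻¹(x_{n,k}) = H¹(Σ_{V̄_{n+j+1}→V̄_n}) sh⁻¹(x_{n+j+1,k})` (the corestrictions are the fibre sums, brick (δ-d2); transitivity of the
fibre sums, brick (δ-a)). [cite: JohnsonLeungKings2011, Def. 4.2 (94) (arXiv p0012:L94)] [cite: NeukirchSchmidtWingberg2008, I §5 Prop. (1.5.3)] -/
theorem coindFinSum_symm_shO_proj (x : D.H) (n k : ℕ) : ∀ j : ℕ,
    cohomologyMap (coindFinSum (coeffGSO S (suppPF p 𝔣) θ k).toTopRep (imGS_le_of_le (suppPF p 𝔣) (pairLayerSubgroup_le κ₁ κ₂ (by omega : n ≤ n + j + 1)))) 1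
        ((shO S (suppPF p 𝔣) θ (isOpen_pairLayerSubgroup κ₁ κ₂ (n + j + 1)) k 1).symm (D.proj (n + j + 1) k x)) =
      (shO S (suppPF p 𝔣) θ (isOpen_pairLayerSubgroup κ₁ κ₂ n) k 1).symm (D.proj n k x) := by
  -- one step: `H¹(Σ_{V̄_{m+1}→V̄_m}) sh⁻¹(x_{m+1,k}) = sh⁻¹(x_{m,k})`
  have hstep : ∀ m : ℕ,
      cohomologyMap (coindFinSum (coeffGSO S (suppPF p 𝔣) θ k).toTopRep (imGS_le_of_le (suppPF p 𝔣) (pairLayerSubgroup_le κ₁ κ₂ (Nat.le_succ m)))) 1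
          ((shO S (suppPF p 𝔣) θ (isOpen_pairLayerSubgroup κ₁ κ₂ (m + 1)) k 1).symm (D.proj (m + 1) k x)) =
        (shO S (suppPF p 𝔣) θ (isOpen_pairLayerSubgroup κ₁ κ₂ m) k 1).symm (D.proj m k x) := fun m => by
    apply (shO S (suppPF p 𝔣) θ (isOpen_pairLayerSubgroup κ₁ κ₂ m) k 1).injective
    rw [shO_coindFinSum, AddEquiv.apply_symm_apply, AddEquiv.apply_symm_apply]
    exact D.proj_cores m k x
  intro j
  induction j with
  | zero => exact hstep n
  | succ j ih =>
    rw [← ih, ← hstep (n + j + 1)]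
    exact (cohomologyMap_comp_apply_of_eq _ _ _ (fun ψ => coindFinSum_coindFinSum _ _ _ ψ) 1 _).symm

/-! ## §3 `𝐇¹[T₂] = 0` -/

/-- ★★★ **`𝐇¹(𝒪_K[1/p𝔣], Λ_𝒪(θ)(1))` HAS NO `T₂`-TORSION**, element form: for a topological generator pair up to units (the frame's `hγ`), every `x ∈ D.H` with
`C (X − C 0) • x = 0` is `0`. Proof: the level components of `x` are `conj_{γ₂}`-fixed (§2) and norm-compatible, so `x_{n,k} = cor_{K̃_{m'}/K̃_n} x_{m',k} = 0` for
`m' = n + 2k + #X_k + 1` by brick (TF-b) (`#X_k ≤ p^{#X_k}`); then (P3). [cite: PerrinRiou1994Invent, §1.3] [cite: JohnsonLeungKings2011, §4.2, Lemma 4.4] [cite: Rubin2000, Ch. VI §6] -/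
theorem eq_zero_of_C_X_smul_eq_zero (hγ : ∃ u₁ u₂ : ℤ_[p]ˣ, ZpExtension.IsTopGeneratorPair (κ₁.unitTwist u₁) (κ₂.unitTwist u₂) γ₁ γ₂) (x : D.H)
    (hx : (PowerSeries.C (PowerSeries.X - PowerSeries.C (0 : padicCoeffIntegers S)) : IwasawaAlgebraO₂ S) • x = 0) : x = 0 := by
  obtain ⟨hγ₁, hγu, hγ₁u⟩ := of_isTopGeneratorPair_unitTwist' κ₁ κ₂ hγ
  refine D.proj_injective x fun n k => ?_
  -- levels: `m = n + k`, `t = #X_k`, `m' = n + (2k + t) + 1`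
  set t : ℕ := Nat.card (coeffGSO S (suppPF p 𝔣) θ k).toTopRep with ht
  have hM : Nat.card (coeffGSO S (suppPF p 𝔣) θ k).toTopRep ≤ p ^ t := (Nat.lt_pow_self (Nat.Prime.one_lt Fact.out)).le
  have hcomp := coindFinSum_symm_shO_proj S κ₁ κ₂ θ 𝔣 D x n k (2 * k + t)
  have hzero := coindFinSum_pair_eq_zero_of_rTransHom_eq (suppPF p 𝔣) S κ₁ κ₂ θ hγ₁ hγu hγ₁u
    (PrintCf2.JLKDescent.ramificationSubgroup_suppPF_le_pairLayerSubgroup κ₁ κ₂ 𝔣) (n := n) (k := k) (m := n + k) (t := t) (m' := n + (2 * k + t) + 1) le_rfl (by omega) hM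
    _ (symm_shO_proj_rTransHom S κ₁ κ₂ θ 𝔣 D x hx (n + (2 * k + t) + 1) k)
  rw [hzero] at hcomp
  exact ((shO S (suppPF p 𝔣) θ (isOpen_pairLayerSubgroup κ₁ κ₂ n) k 1).symm.map_eq_zero_iff).1 hcomp.symm

/-- ★★★ **`𝐇¹(𝒪_K[1/p𝔣], Λ_𝒪(θ)(1))[T₂] = 0`** — the INPUT «hTF» (row (4′)) of the road-D frame in its true form: for every number field `K`, every `p`, every pair of `ℤ_p`-extensions
`κ₁, κ₂` with a topological generator pair `(γ₁, γ₂)` up to unit twists, every continuous character `θ : Γ_K → 𝒪ˣ`, every `𝔣` and every pinned `D : IwasawaCohomologyDataO S κ₁ κ₂ γ₁ γ₂ θ 𝔣 1`: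
`torsionBy Λ_{𝒪,2} D.H (C (X − C 0)) = ⊥`. In the frame of `stub_charRoadFrame_ns_of₂`: `κ₁ := κ.restrictOfFinrankEqTwo hp K hK2`, `γ₁ := γK⁻¹`, `hγ := ⟨u₁, u₂, hpair⟩`.
[cite: PerrinRiou1994Invent, §1.3] [cite: JohnsonLeungKings2011, §4.2, Lemma 4.4] [cite: Rubin2000, Ch. VI §6] -/
theorem torsionBy_C_X_eq_bot (hγ : ∃ u₁ u₂ : ℤ_[p]ˣ, ZpExtension.IsTopGeneratorPair (κ₁.unitTwist u₁) (κ₂.unitTwist u₂) γ₁ γ₂) :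
    Submodule.torsionBy (IwasawaAlgebraO₂ S) D.H
        (PowerSeries.C (PowerSeries.X - PowerSeries.C (0 : padicCoeffIntegers S) : PowerSeries (padicCoeffIntegers S)) : IwasawaAlgebraO₂ S) = ⊥ := by
  rw [Submodule.eq_bot_iff]
  intro x hx
  exact eq_zero_of_C_X_smul_eq_zero S κ₁ κ₂ θ 𝔣 D hγ x ((Submodule.mem_torsionBy_iff _ x).1 hx)

end Pinned

end Summit.BirchSwinnertonDyer.BirchSwinnertonDyer.Theorems.SmallImageRttD2TF

end
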